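import Summits.Ventures.HSemireg.Mod4IdealShapePinZero

/-!
# Venture HSemireg — MOD-4 line: the DETERMINANT IDENTITY of an `I_Z`-SHAPE h-part — `det(T_f(q) − X) = det(T_f(q⁰) − X)
# + (−1)ⁿ q_0 · det B⁻(X)`, `B⁻(X)` the `n × n` upper Hessenberg block (rows `0…n−1`, columns `1…n`) of `T_f(q⁰) − X`; hence the
# two bits of the `I_Z` row at the extreme pin `q_n²` in closed form

HONEST FRAMING. Part of the Lean index of the computation cell `pub-hsemireg` (seat w3-mod4-1 gen 15, W3 SPECIAL FIBRES; file of
record `HOME/widen/W3/MOD4-OFFSPLIT-w3mod4.md` §13.33–13.35). `Mod4IdealShapePinZero` left the second bit `[det(T_f(q) + q_n) = 0]`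
of the `I_Z` middle entry at `q_n²` without a closed form; this file supplies it. ELEMENTARY LINEAR ALGEBRA over a field ONLY: no
abelian variety, no sheaf, no Ext group, no semiregularity map; nothing here says that HC / HC_CM / HC_AV holds; no Literature fact is
declared; NO definition is introduced.

SETTING: `q⁰ = q[0 ↦ 0]`; `T_f(q)` and `T_f(q⁰)` differ only at the corner `(n, 0)`, where `T_f(q)_{n0} = q_0` (index `n − a + b = 0`
forces `a = n`, `b = 0`). WHAT IS PROVED (any `q`, any scalar `X`, `1 ≤ n`):
* **`hankelT_sub_eq_updateRow`** — `T_f(q) − X = (T_f(q⁰) − X)` with `q_0 · e_0` added to its last row;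
* **`det_hankelT_idealShape_sub`** — `det(T_f(q) − X) = det(T_f(q⁰) − X) + (−1)ⁿ q_0 · det B⁻(X)`,
  `B⁻(X) = ((T_f(q⁰) − X)_{r, s+1})_{r,s<n}` (Laplace along the last row: `Matrix.det_succ_row`, only the column `0` survives, and the
  minor `submatrix Fin.castSucc Fin.succ` is the block) — `B⁻` enters as a hypothesis `hB : B = Matrix.of …`, no definition;
* for an `I_Z` SHAPE (`q_m = 0` for `1 ≤ m < n`, so `q⁰` is a leading shape and `T_f(q⁰) − X` is triangular):
  **`det_hankelT_idealShape_sub_pin_zero`** — at `X = q_n` (even `n`): `det(T_f(q) − q_n) = (−1)ⁿ q_0 · det B_0` (`B_0` = the pin block of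
  `Mod4LeadingTermPinCriterion` at `a = 0`; the triangular determinant vanishes at the zero pivot) — the first bit of §13.33 again;
  **`det_hankelT_idealShape_add_pin_zero`** — at `X = −q_n`: `det(T_f(q) + q_n) = Π_b ((−1)^b C(n,b) q_n + q_n) + (−1)ⁿ q_0 · det B⁻(−q_n)`,
  the product being non-zero for even `n` (`Mod4LeadingTermPinsEven`) — THE SECOND BIT IN CLOSED FORM;
  **`finrank_ker_hankelT_idealShape_add_pin_zero_eq_zero_iff`** — `ker(T_f(q) + q_n) = ⊥ ↔ that determinant ≠ 0`.
Everything PROVED, 0 sorry. Namespace `Summit.Ventures.HSemireg.Mod4`. References: [BourbakiAlgebre1a3] Ch. III §8 (Laplace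
expansion); [BuchweitzFlenner2008HH] Prop. 6.4.4 (why these matrices).
-/

namespace Summit.Ventures.HSemireg.Mod4

open Finset Matrix

variable {K : Type*} [Field K]

/-- **`T_f(q) − X` is `T_f(q⁰) − X` with `q_0·e_0` added to the last row** (`q⁰ = q[0 ↦ 0]`). [cite: BourbakiAlgebre1a3, Ch. III §8] -/
theorem hankelT_sub_eq_updateRow (n : ℕ) (q : ℕ → K) (X : K) :
    hankelT n q - X • (1 : Matrix (Fin (n + 1)) (Fin (n + 1)) K) =
      (hankelT n (Function.update q 0 0) - X • (1 : Matrix (Fin (n + 1)) (Fin (n + 1)) K)).updateRow (Fin.last n)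
        ((hankelT n (Function.update q 0 0) - X • (1 : Matrix (Fin (n + 1)) (Fin (n + 1)) K)) (Fin.last n) +
          q 0 • Pi.single (0 : Fin (n + 1)) (1 : K)) := by
  ext a b
  have ha := a.isLt
  have hb := b.isLt
  rw [Matrix.updateRow_apply]
  by_cases hal : a = Fin.last n
  · rw [if_pos hal, Pi.add_apply, Pi.smul_apply, Matrix.sub_apply, Matrix.sub_apply, hankelT_apply, hankelT_apply, hal,
      Fin.val_last, smul_eq_mul]
    by_cases hb0 : b = 0
    · rw [hb0, Pi.single_eq_same, Fin.val_zero, show n - n + 0 = 0 by omega, Function.update_self, mul_one]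
      simp only [pow_zero, Nat.choose_zero_right, Nat.cast_one, one_mul, mul_zero, zero_sub]
      ring
    · have hb0' : (b : ℕ) ≠ 0 := fun h => hb0 (Fin.ext h)
      rw [Pi.single_eq_of_ne hb0, Function.update_of_ne (show n - n + (b : ℕ) ≠ 0 by omega), mul_zero, add_zero]
  · rw [if_neg hal, Matrix.sub_apply, Matrix.sub_apply, hankelT_apply, hankelT_apply]
    have hal' : (a : ℕ) ≠ n := fun h => hal (Fin.ext (by rw [h, Fin.val_last]))
    rw [Function.update_of_ne (show n - (a : ℕ) + (b : ℕ) ≠ 0 by omega)]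

/-- **THE DETERMINANT IDENTITY:** `det(T_f(q) − X) = det(T_f(q⁰) − X) + (−1)ⁿ q_0 · det B⁻(X)` with
`B⁻(X) = ((T_f(q⁰) − X)_{r, s+1})_{r,s<n}` (Laplace along the last row). [cite: BourbakiAlgebre1a3, Ch. III §8] -/
theorem det_hankelT_idealShape_sub (n : ℕ) (q : ℕ → K) (X : K) {B : Matrix (Fin n) (Fin n) K}
    (hB : B = Matrix.of fun r s : Fin n =>
      (hankelT n (Function.update q 0 0) - X • (1 : Matrix (Fin (n + 1)) (Fin (n + 1)) K)) (Fin.castSucc r) (Fin.succ s)) :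
    (hankelT n q - X • (1 : Matrix (Fin (n + 1)) (Fin (n + 1)) K)).det =
      (hankelT n (Function.update q 0 0) - X • (1 : Matrix (Fin (n + 1)) (Fin (n + 1)) K)).det + (-1 : K) ^ n * q 0 * B.det := by
  set V := hankelT n (Function.update q 0 0) - X • (1 : Matrix (Fin (n + 1)) (Fin (n + 1)) K) with hV
  have hsubm : (V.updateRow (Fin.last n) (Pi.single (0 : Fin (n + 1)) (1 : K))).submatrix (Fin.last n).succAbove
      (0 : Fin (n + 1)).succAbove = B := by
    ext r s
    rw [Matrix.submatrix_apply, Fin.succAbove_last, Fin.succAbove_zero, Matrix.updateRow_ne (Fin.castSucc_ne_last r), hB,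
      Matrix.of_apply]
  have hL : (V.updateRow (Fin.last n) (Pi.single (0 : Fin (n + 1)) (1 : K))).det = (-1 : K) ^ n * B.det := by
    rw [Matrix.det_succ_row _ (Fin.last n), Finset.sum_eq_single (0 : Fin (n + 1))]
    · rw [Matrix.updateRow_self, Pi.single_eq_same, mul_one, Fin.val_last, Fin.val_zero, add_zero, hsubm]
    · intro j _ hj
      rw [Matrix.updateRow_self, Pi.single_eq_of_ne hj, mul_zero, zero_mul]
    · intro h
      exact absurd (Finset.mem_univ _) h
  rw [hankelT_sub_eq_updateRow n q X, ← hV, Matrix.det_updateRow_add, Matrix.updateRow_eq_self, Matrix.det_updateRow_smul, hL]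
  ring

/-- **the first bit again:** for an `I_Z` shape (`q_m = 0`, `1 ≤ m < n`), even `n ≥ 1`: `det(T_f(q) − q_n) = (−1)ⁿ q_0 · det B_0`, where
`B_0` is the pin block at `a = 0` of `T_f(q⁰) − q_n` (its triangular determinant vanishes at the zero pivot `b = 0`).
[cite: BourbakiAlgebre1a3, Ch. III §8] -/
theorem det_hankelT_idealShape_sub_pin_zero {n : ℕ} (hn : 1 ≤ n) {q : ℕ → K} (hq : ∀ m, 1 ≤ m → m < n → q m = 0)
    {B : Matrix (Fin n) (Fin n) K}
    (hB : B = Matrix.of fun r s : Fin n =>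
      (hankelT n (Function.update q 0 0) - q n • (1 : Matrix (Fin (n + 1)) (Fin (n + 1)) K)) ⟨0 + r, by omega⟩
        ⟨0 + 1 + s, by omega⟩) :
    (hankelT n q - q n • (1 : Matrix (Fin (n + 1)) (Fin (n + 1)) K)).det = (-1 : K) ^ n * q 0 * B.det := by
  obtain ⟨hq0', hqn'⟩ := idealShape_update_zero hn hq
  have e1 : ∀ r : Fin n, (⟨0 + (r : ℕ), by omega⟩ : Fin (n + 1)) = Fin.castSucc r := fun r => Fin.ext (by simp)
  have e2 : ∀ s : Fin n, (⟨0 + 1 + (s : ℕ), by omega⟩ : Fin (n + 1)) = Fin.succ s :=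
    fun s => Fin.ext (by simp [Fin.val_succ]; omega)
  have hB' : B = Matrix.of fun r s : Fin n =>
      (hankelT n (Function.update q 0 0) - q n • (1 : Matrix (Fin (n + 1)) (Fin (n + 1)) K)) (Fin.castSucc r) (Fin.succ s) := by
    rw [hB]
    ext r s
    rw [Matrix.of_apply, Matrix.of_apply, e1 r, e2 s]
  rw [det_hankelT_idealShape_sub n q (q n) hB']
  -- the triangular determinant vanishes: pivot `b = 0` is `q⁰_n − q_n = 0`
  have hdet : (hankelT n (Function.update q 0 0) - q n • (1 : Matrix (Fin (n + 1)) (Fin (n + 1)) K)).det = 0 := by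
    rw [Matrix.det_of_upperTriangular (blockTriangular_hankelT_leading_sub hq0' (q n))]
    refine Finset.prod_eq_zero (Finset.mem_univ (⟨0, by omega⟩ : Fin (n + 1))) ?_
    rw [Matrix.sub_apply, Matrix.smul_apply, Matrix.one_apply_eq, smul_eq_mul, mul_one, hankelT_apply]
    simp only [pow_zero, Nat.choose_zero_right, Nat.cast_one, one_mul, Nat.sub_zero, add_zero]
    rw [hqn', sub_self]
  rw [hdet, zero_add]

/-- **THE SECOND BIT IN CLOSED FORM:** for an `I_Z` shape (`q_m = 0`, `1 ≤ m < n`), `n ≥ 1`: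
`det(T_f(q) + q_n) = Π_b ((−1)^b C(n,b) q_n + q_n) + (−1)ⁿ q_0 · det B⁻`, `B⁻ = ((T_f(q⁰) + q_n)_{r, s+1})_{r,s<n}`.
[cite: BourbakiAlgebre1a3, Ch. III §8] -/
theorem det_hankelT_idealShape_add_pin_zero {n : ℕ} (hn : 1 ≤ n) {q : ℕ → K} (hq : ∀ m, 1 ≤ m → m < n → q m = 0)
    {B : Matrix (Fin n) (Fin n) K}
    (hB : B = Matrix.of fun r s : Fin n =>
      (hankelT n (Function.update q 0 0) + q n • (1 : Matrix (Fin (n + 1)) (Fin (n + 1)) K)) (Fin.castSucc r) (Fin.succ s)) :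
    (hankelT n q + q n • (1 : Matrix (Fin (n + 1)) (Fin (n + 1)) K)).det =
      (∏ b : Fin (n + 1), ((-1 : K) ^ (b : ℕ) * (n.choose (b : ℕ) : K) * q n + q n)) + (-1 : K) ^ n * q 0 * B.det := by
  obtain ⟨hq0', hqn'⟩ := idealShape_update_zero hn hq
  have hsub : ∀ p : ℕ → K, hankelT n p + q n • (1 : Matrix (Fin (n + 1)) (Fin (n + 1)) K) =
      hankelT n p - (-q n) • (1 : Matrix (Fin (n + 1)) (Fin (n + 1)) K) := fun p => by rw [neg_smul, sub_neg_eq_add]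
  have hB' : B = Matrix.of fun r s : Fin n =>
      (hankelT n (Function.update q 0 0) - (-q n) • (1 : Matrix (Fin (n + 1)) (Fin (n + 1)) K)) (Fin.castSucc r) (Fin.succ s) := by
    rw [hB, hsub]
  rw [hsub, det_hankelT_idealShape_sub n q (-q n) hB']
  congr 1
  rw [Matrix.det_of_upperTriangular (blockTriangular_hankelT_leading_sub hq0' (-q n))]
  refine Finset.prod_congr rfl fun b _ => ?_
  have hb := b.isLt
  rw [Matrix.sub_apply, Matrix.smul_apply, Matrix.one_apply_eq, smul_eq_mul, mul_one, hankelT_apply,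
    show n - (b : ℕ) + (b : ℕ) = n by omega, hqn', sub_neg_eq_add]

/-- **the second bit as a kernel statement** (even `n ≥ 1`, `I_Z` shape, `q_n ≠ 0`): `ker(T_f(q) + q_n) = ⊥` iff
`Π_b ((−1)^b C(n,b) q_n + q_n) + (−1)ⁿ q_0 · det B⁻ ≠ 0`; otherwise that kernel is `1`-dimensional (`Mod4IdealShapePinZero`).
[cite: BourbakiAlgebre1a3, Ch. III §8] -/
theorem ker_hankelT_idealShape_add_pin_zero_eq_bot_iff {n : ℕ} (hn : 1 ≤ n) {q : ℕ → K}
    (hq : ∀ m, 1 ≤ m → m < n → q m = 0) {B : Matrix (Fin n) (Fin n) K}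
    (hB : B = Matrix.of fun r s : Fin n =>
      (hankelT n (Function.update q 0 0) + q n • (1 : Matrix (Fin (n + 1)) (Fin (n + 1)) K)) (Fin.castSucc r) (Fin.succ s)) :
    LinearMap.ker (Matrix.toLin' (hankelT n q) + q n • LinearMap.id) = ⊥ ↔
      (∏ b : Fin (n + 1), ((-1 : K) ^ (b : ℕ) * (n.choose (b : ℕ) : K) * q n + q n)) + (-1 : K) ^ n * q 0 * B.det ≠ 0 := by
  rw [← det_hankelT_idealShape_add_pin_zero hn hq hB]
  have hlin : Matrix.toLin' (hankelT n q) + q n • LinearMap.id =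
      Matrix.toLin' (hankelT n q + q n • (1 : Matrix (Fin (n + 1)) (Fin (n + 1)) K)) := by
    rw [map_add, map_smul, Matrix.toLin'_one]
  rw [hlin, Matrix.ker_toLin'_eq_bot_iff]
  constructor
  · intro h hdet
    obtain ⟨v, hv0, hv⟩ := Matrix.exists_mulVec_eq_zero_iff.mpr hdet
    exact hv0 (h v hv)
  · intro h v hv
    by_contra hv0
    exact h (Matrix.exists_mulVec_eq_zero_iff.mp ⟨v, hv0, hv⟩)

end Summit.Ventures.HSemireg.Mod4
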